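import Summits.QuantumAdvantage.AdviceFreeQNC0.LDMATransfer
import HarnessLib

/-!
# Cell qa-qnc0 (rung F-Q1, route RingFrame, crux α, line `product`): the `0/1` Walsh matrix is
# non-singular mod 3

Second engine behind `CubeCover` (planner qa-qnc0-p1 THEOREM-TARGET T6(b), HOME/qa-qnc0-p1/ROUND-8.md
§1(b): "the 0/1 Walsh matrix `W = ([⟨S,α⟩ = 1])_{α ≠ 0, S ≠ ∅}` is invertible mod 3").  We prove the
form the cube count needs, WITHOUT eigenvalues:

* `exists_subsetParSum_ne_zero`: for any family `p` of NONEMPTY subsets `R` of a finite index set and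
  any coefficients `ζ : Finset ι → ℤ/3` with `ζ T ≠ 0` for some `T` in the family, there is a point
  `α ∈ {0,1}^ι` with `Σ_{R ∈ p, ⟨1_R, α⟩ = 1} ζ R ≠ 0 (mod 3)`.

Proof: with the signs `χ_R(α) = (−1)^{⟨1_R,α⟩} ∈ ℤ/3` one has `ζ_R χ_R = ζ_R − 2 ζ_R [⟨1_R,α⟩ = 1]`,
so if every parity sum vanished then `F(α) := Σ_R ζ_R χ_R(α)` would be the constant `σ = Σ_R ζ_R`;
but the signs are orthogonal (`sum_sgn3_mul_sgn3`: `Σ_α χ_R χ_T = 2^{|ι|}[R = T]`, by the bit-flip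
involution at a coordinate separating `R` from `T`), so `Σ_α F χ_T = ζ_T 2^{|ι|}` while
`Σ_α σ χ_T = σ Σ_α χ_∅ χ_T = 0` for `T ≠ ∅`; `2` is a unit mod `3`.  Also the parity calculus
(`subsetPar_insert`, `subsetPar_update_of_mem/_of_notMem`, `flipBit`) used by `CubeCover*.lean`.
WHAT THIS IS NOT: nothing on `FSB`/`FW`/α; no separation claim.  [folklore]
-/

namespace Summit.QuantumAdvantage.AdviceFreeQNC0

namespace CubeChar

open Finset

variable {ι : Type*} [DecidableEq ι]

/-! ### Parities of a `0/1` vector on subsets -/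

/-- `⟨1_R, α⟩ ∈ 𝔽₂`: the parity of the number of `i ∈ R` with `α i = 1`. -/
def subsetPar (R : Finset ι) (α : ι → Bool) : Bool :=
  decide ((R.filter fun i => α i = true).card % 2 = 1)

omit [DecidableEq ι] in
/-- `⟨1_∅, α⟩ = 0`. -/
@[simp] theorem subsetPar_empty (α : ι → Bool) : subsetPar ∅ α = false := by
  simp [subsetPar]

omit [DecidableEq ι] in
/-- `⟨1_R, 0⟩ = 0`. -/
@[simp] theorem subsetPar_zero (R : Finset ι) : subsetPar R (fun _ => false) = false := by
  simp [subsetPar]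

omit [DecidableEq ι] in
/-- Parities only read the coordinates in `R`. -/
theorem subsetPar_congr {R : Finset ι} {α β : ι → Bool} (h : ∀ j ∈ R, α j = β j) :
    subsetPar R α = subsetPar R β := by
  unfold subsetPar
  rw [Finset.filter_congr fun j hj => by rw [h j hj]]

/-- Parity flips under successor. -/
private theorem decide_succ_mod_two' (n : ℕ) : decide ((n + 1) % 2 = 1) = !decide (n % 2 = 1) := by
  rcases Nat.mod_two_eq_zero_or_one n with hn | hn
  · have h1 : (n + 1) % 2 = 1 := by omega
    simp [hn, h1]
  · have h1 : (n + 1) % 2 = 0 := by omega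
    simp [hn, h1]

/-- `⟨1_{R ∪ {i}}, α⟩ = α_i + ⟨1_R, α⟩` for `i ∉ R`. -/
theorem subsetPar_insert {R : Finset ι} {i : ι} (hi : i ∉ R) (α : ι → Bool) :
    subsetPar (insert i R) α = xor (α i) (subsetPar R α) := by
  unfold subsetPar
  rw [Finset.filter_insert]
  by_cases h : α i = true
  · rw [if_pos h, Finset.card_insert_of_notMem (fun h' => hi (Finset.mem_filter.1 h').1), h,
      decide_succ_mod_two', Bool.true_xor]
  · rw [if_neg h]
    have h' : α i = false := by simpa using h
    rw [h', Bool.false_xor]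

/-- `⟨1_{{i}}, α⟩ = α_i`. -/
@[simp] theorem subsetPar_singleton (i : ι) (α : ι → Bool) : subsetPar {i} α = α i := by
  rw [← Finset.insert_empty, subsetPar_insert (Finset.notMem_empty i), subsetPar_empty, Bool.xor_false]

/-- Changing a coordinate outside `R` does not change `⟨1_R, α⟩`. -/
theorem subsetPar_update_of_notMem {R : Finset ι} {i : ι} (hi : i ∉ R) (α : ι → Bool) (b : Bool) :
    subsetPar R (Function.update α i b) = subsetPar R α :=
  subsetPar_congr fun j hj => by rw [Function.update_of_ne (ne_of_mem_of_not_mem hj hi)]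

/-- Changing the coordinate `i ∈ R` to `b` changes `⟨1_R, α⟩` by `α_i + b`. -/
theorem subsetPar_update_of_mem {R : Finset ι} {i : ι} (hi : i ∈ R) (α : ι → Bool) (b : Bool) :
    subsetPar R (Function.update α i b) = xor (xor (α i) b) (subsetPar R α) := by
  rw [← Finset.insert_erase hi, subsetPar_insert (Finset.notMem_erase i R),
    subsetPar_insert (Finset.notMem_erase i R), subsetPar_update_of_notMem (Finset.notMem_erase i R),
    Function.update_self]
  cases α i <;> cases b <;> cases subsetPar (R.erase i) α <;> rfl

/-- The symmetric-difference law restricted to what the cube argument needs: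
`⟨1_{R.erase i}, α⟩ + ⟨1_S, α⟩ = ⟨1_{(R.erase i) ∆ S}, α⟩`. -/
theorem subsetPar_symmDiff (P S : Finset ι) (α : ι → Bool) :
    subsetPar (symmDiff P S) α = xor (subsetPar P α) (subsetPar S α) := by
  induction S using Finset.induction_on generalizing P with
  | empty =>
    have e : symmDiff P ∅ = P := by ext j; simp [Finset.mem_symmDiff]
    rw [e, subsetPar_empty, Bool.xor_false]
  | insert i S hi ih =>
    rw [subsetPar_insert hi]
    by_cases hP : i ∈ P
    · -- `P ∆ (insert i S) = (P.erase i) ∆ S`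
      have e : symmDiff P (insert i S) = symmDiff (P.erase i) S := by
        ext j
        simp only [Finset.mem_symmDiff, Finset.mem_insert, Finset.mem_erase]
        by_cases hj : j = i
        · subst hj; simp [hP, hi]
        · simp [hj]
      rw [e, ih (P.erase i), ← Finset.insert_erase hP, subsetPar_insert (Finset.notMem_erase i P),
        Finset.erase_insert (Finset.notMem_erase i P)]
      cases α i <;> cases subsetPar (P.erase i) α <;> cases subsetPar S α <;> rfl
    · -- `P ∆ (insert i S) = insert i (P ∆ S)`
      have e : symmDiff P (insert i S) = insert i (symmDiff P S) := by
        ext j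
        simp only [Finset.mem_symmDiff, Finset.mem_insert]
        by_cases hj : j = i
        · subst hj; simp [hP, hi]
        · simp [hj]
      have hi' : i ∉ symmDiff P S := by
        rw [Finset.mem_symmDiff]; push Not; exact ⟨fun h => absurd h hP, fun h => absurd h hi⟩
      rw [e, subsetPar_insert hi', ih P]
      cases α i <;> cases subsetPar P α <;> cases subsetPar S α <;> rfl

/-! ### Bit flips and the signs `(−1)^{⟨1_R, α⟩}` in `ℤ/3` -/

/-- Flip the `i`-th bit. -/
def flipBit (i : ι) (α : ι → Bool) : ι → Bool := Function.update α i (!α i)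

/-- Flipping twice is the identity. -/
theorem flipBit_flipBit (i : ι) (α : ι → Bool) : flipBit i (flipBit i α) = α := by
  funext j
  unfold flipBit
  by_cases hj : j = i
  · subst hj; simp
  · simp [Function.update_of_ne hj]

/-- `(−1)^{⟨1_R, α⟩} ∈ ℤ/3`. -/
def sgn3 (R : Finset ι) (α : ι → Bool) : ZMod 3 := if subsetPar R α = true then -1 else 1

omit [DecidableEq ι] in
/-- `χ_∅ = 1`. -/
@[simp] theorem sgn3_empty (α : ι → Bool) : sgn3 ∅ α = 1 := by simp [sgn3]

omit [DecidableEq ι] in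
/-- `χ_R² = 1`. -/
theorem sgn3_mul_self (R : Finset ι) (α : ι → Bool) : sgn3 R α * sgn3 R α = 1 := by
  unfold sgn3; split_ifs <;> ring

/-- Flipping a bit inside `R` negates `χ_R`. -/
theorem sgn3_flipBit_of_mem {R : Finset ι} {i : ι} (hi : i ∈ R) (α : ι → Bool) :
    sgn3 R (flipBit i α) = -sgn3 R α := by
  unfold sgn3 flipBit
  rw [subsetPar_update_of_mem hi]
  cases α i <;> cases subsetPar R α <;> simp

/-- Flipping a bit outside `R` leaves `χ_R` unchanged. -/
theorem sgn3_flipBit_of_notMem {R : Finset ι} {i : ι} (hi : i ∉ R) (α : ι → Bool) :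
    sgn3 R (flipBit i α) = sgn3 R α := by
  unfold sgn3 flipBit
  rw [subsetPar_update_of_notMem hi]

/-- **Orthogonality of the signs.** `Σ_α χ_R(α) χ_T(α) = 2^{|ι|}·[R = T]` in `ℤ/3`. -/
theorem sum_sgn3_mul_sgn3 [Fintype ι] (R T : Finset ι) :
    ∑ α : ι → Bool, sgn3 R α * sgn3 T α = if R = T then (2 : ZMod 3) ^ Fintype.card ι else 0 := by
  by_cases hRT : R = T
  · subst hRT
    rw [if_pos rfl, Finset.sum_congr rfl fun α _ => sgn3_mul_self R α, Finset.sum_const,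
      Finset.card_univ, Fintype.card_fun, Fintype.card_bool, nsmul_eq_mul, mul_one]
    push_cast
    rfl
  · rw [if_neg hRT]
    obtain ⟨i, hi⟩ : ∃ i, ¬ (i ∈ R ↔ i ∈ T) := by
      by_contra h
      push Not at h
      exact hRT (Finset.ext h)
    have hflip : ∀ α : ι → Bool, sgn3 R (flipBit i α) * sgn3 T (flipBit i α) = -(sgn3 R α * sgn3 T α) := by
      intro α
      by_cases hR : i ∈ R
      · have hT : i ∉ T := fun hT => hi ⟨fun _ => hT, fun _ => hR⟩
        rw [sgn3_flipBit_of_mem hR, sgn3_flipBit_of_notMem hT]; ring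
      · have hT : i ∈ T := by
          by_contra hT; exact hi ⟨fun h => absurd h hR, fun h => absurd h hT⟩
        rw [sgn3_flipBit_of_notMem hR, sgn3_flipBit_of_mem hT]; ring
    have hsum : ∑ α : ι → Bool, sgn3 R α * sgn3 T α =
        ∑ α : ι → Bool, sgn3 R (flipBit i α) * sgn3 T (flipBit i α) :=
      (Equiv.sum_comp (Function.Involutive.toPerm (flipBit i) (flipBit_flipBit i))
        (fun α => sgn3 R α * sgn3 T α)).symm
    rw [Finset.sum_congr rfl fun α _ => hflip α, Finset.sum_neg_distrib] at hsum
    -- `S = −S` forces `S = 0` since `2·2 = 1` in `ℤ/3`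
    set S := ∑ α : ι → Bool, sgn3 R α * sgn3 T α with hS
    have h22 : (2 : ZMod 3) * 2 = 1 := by decide
    have h2S : (2 : ZMod 3) * S = 0 := by
      rw [two_mul]
      nth_rewrite 2 [hsum]
      exact add_neg_cancel S
    calc S = (2 : ZMod 3) * 2 * S := by rw [h22, one_mul]
      _ = 2 * (2 * S) := by ring
      _ = 0 := by rw [h2S, mul_zero]

/-- **The `0/1` Walsh matrix is non-singular mod 3** (the form the cube count uses): if
`ζ : Finset ι → ℤ/3` does not vanish at some member `T` of a family `p` of nonempty subsets, then
some `α ∈ {0,1}^ι` has `Σ_{R ∈ p : ⟨1_R, α⟩ = 1} ζ R ≠ 0`. -/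
theorem exists_subsetParSum_ne_zero [Fintype ι] (p : Finset ι → Prop) [DecidablePred p]
    (hp : ∀ R, p R → R.Nonempty) (ζ : Finset ι → ZMod 3) {T : Finset ι} (hT : p T) (hζT : ζ T ≠ 0) :
    ∃ α : ι → Bool,
      (∑ R ∈ (univ : Finset (Finset ι)).filter p, if subsetPar R α = true then ζ R else 0) ≠ 0 := by
  by_contra H
  push Not at H
  set PP := (univ : Finset (Finset ι)).filter p with hPP
  have hTPP : T ∈ PP := Finset.mem_filter.2 ⟨Finset.mem_univ _, hT⟩
  -- `F(α) = Σ_R ζ_R χ_R(α)` is the constant `σ`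
  have hF : ∀ α : ι → Bool, ∑ R ∈ PP, ζ R * sgn3 R α = ∑ R ∈ PP, ζ R := by
    intro α
    have e : ∀ R, ζ R * sgn3 R α = ζ R - 2 * (if subsetPar R α = true then ζ R else 0) := by
      intro R; unfold sgn3; split_ifs <;> ring
    rw [Finset.sum_congr rfl fun R _ => e R, Finset.sum_sub_distrib, ← Finset.mul_sum, H α, mul_zero,
      sub_zero]
  -- `X = Σ_α F(α) χ_T(α)` two ways
  have hX1 : ∑ α : ι → Bool, (∑ R ∈ PP, ζ R * sgn3 R α) * sgn3 T α = 0 := by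
    rw [Finset.sum_congr rfl fun α _ => by rw [hF α], ← Finset.mul_sum]
    have h0 : ∑ α : ι → Bool, sgn3 T α = 0 := by
      have h := sum_sgn3_mul_sgn3 (∅ : Finset ι) T
      rw [Finset.sum_congr rfl fun α _ => by rw [sgn3_empty, one_mul]] at h
      rw [h, if_neg fun e => (hp T hT).ne_empty e.symm]
    rw [h0, mul_zero]
  have hX2 : ∑ α : ι → Bool, (∑ R ∈ PP, ζ R * sgn3 R α) * sgn3 T α =
      ζ T * (2 : ZMod 3) ^ Fintype.card ι := by
    rw [Finset.sum_congr rfl fun α _ => by rw [Finset.sum_mul], Finset.sum_comm]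
    have e : ∀ R ∈ PP, ∑ α : ι → Bool, ζ R * sgn3 R α * sgn3 T α =
        if R = T then ζ T * (2 : ZMod 3) ^ Fintype.card ι else 0 := by
      intro R _
      rw [Finset.sum_congr rfl fun α _ => by rw [mul_assoc], ← Finset.mul_sum, sum_sgn3_mul_sgn3]
      split_ifs with h
      · rw [h]
      · rw [mul_zero]
    rw [Finset.sum_congr rfl e, Finset.sum_ite_eq' PP T, if_pos hTPP]
  rw [hX2] at hX1
  have h22 : ((2 : ZMod 3) ^ Fintype.card ι) * (2 : ZMod 3) ^ Fintype.card ι = 1 := by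
    rw [← mul_pow, show (2 : ZMod 3) * 2 = 1 by decide, one_pow]
  apply hζT
  calc ζ T = ζ T * (2 : ZMod 3) ^ Fintype.card ι * (2 : ZMod 3) ^ Fintype.card ι := by
        rw [mul_assoc, h22, mul_one]
    _ = 0 := by rw [hX1, zero_mul]

end CubeChar

end Summit.QuantumAdvantage.AdviceFreeQNC0
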